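import Summits.QuantumFields.BalabanUV.Beta.GAN24.HalfMemberSlavedDivergence
import Summits.QuantumFields.BalabanUV.Beta.GAN24.CombAffineUnrollProjected
import Summits.QuantumFields.BalabanUV.Beta.CombChartHColumnWard

/-!
# `BalabanUV.Beta.GAN24.CombHalfMemberSlavedDivergence` — binder row G-an2-4 ∕ (CONV-C), TRANSFER-III (the (α-0) chain at row D1's literal of record (III′)),
# link L8b: **THE (III′) TWIN OF (α-END-b1) «THE EVEN MEMBER's SLAVED DIVERGENCE» — T-EQ ON THE `ε`-MEMBER OF THE COMB-CHART `T₂` TOWER (hypothesis-free)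
# AND ITS SLAVING BY THE TWO RAW TABLE LAWS, SPLIT BY PARITY: at `ε = 1` (the EVEN member) the remainder `R` is gone, at `ε = −1` (the ODD member) the
# commutator is gone** — MY lineage's (E) files `HalfMemberSlavedDivergence` §1 (gen 72) + `HalfMemberSlavedDivergenceComb` (gen 72) RE-RUN at the sym ∕ comb slot
# data `(GcombSh Lc ·, SpureCombOf tabs, tabs.M, tabs.vh₂S, tabs.mixFF)` of an2's comb-chart literal `JsB12CombShSym`
# (G-an2-4 CRUX TEAM (2), leaf prover `b2b-balaban-gan24-formalise-leaf-01`, gen 80; the OWNER gan24-p1 g46's (III′) link table R-gan24p1-g46-2, row «L8b–L9 …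
# INSTANCE-stated … first refusal = the (E) authors file by file»; no existing file touched)

NOT IN PRINT; OUR BOOKKEEPING ([folklore] compositions BY NAME over EXISTING objects; the §1–§2 statements are the (E) files' with
`(coDressKBmAt ρ Lc (KInvStep Lc ·), T2RecAt ρ, SpureRecAt ρ, M1At ρ cΛ, vh₂S, mixFFAt ρ Lc) ↦ (GcombSh Lc ·, T2RecOf … (GcombSh Lc) (SpureCombOf tabs …) tabs.M …, SpureCombOf tabs,
tabs.M, tabs.vh₂S, tabs.mixFF)`, the root binders `hLc hr` and the border class `hB` ↦ the record `tabs : SymTables d Lc` (its `tabs.hB`); proofs token for token;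
0 `def`, 0 cited facts, 0 `def … : Prop`, 0 sorry).  HONEST FRAMING (cell contract, verbatim): «discharging `BetaPertH` makes Bałaban's UV stability UNCONDITIONAL — a
real constructive-QFT result; it is NOT the continuum limit and NOT the Clay problem.»  HONEST DEPENDENCY (verbatim): «continuum YM on T⁴ ⇐ BetaPertH ∧ nine spine
estimates (0/9 proved); BetaPertH ⇐ (D1) ∧ (D4) ∧ CAP+tail; G-an2-4 gates asym, D1 and NE2/3/4.»

WHY (context only; asserted nowhere below).  At the chart-(II) literal (E) the even member's slot divergences one level up are SLAVED to level-`j` first-order data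
(the (b1) chain, in the import closure of the (α-0) END `WrecAtEvenHalfRowsOfTowerEnd` through `T2Shape∕DriftEvenMemberOfWardLetters`).  The OWNER's T5
`CombT2DriftEvenEnd` §1 already re-typed the chain's FIRST link at (III′) — the `ε`-member's one-step law `halfMember_comb_succ_eq` (not importable at
filing time: no hub olean; re-run below as a private `c`-weighted proof device, one home per statement = T5) — and the ℋ-column Ward law of
`G′_j = GcombSh Lc j` is an2's `CombChartHColumnWard.colH_ward_GcombSh`; so the (III′) twins of the chain's next two files are compositions by name.  This file types them.

WHAT (objects EXACTLY as in the OWNER's T5 §1: comb-chart literal `T̃′_j := T2RecOf d Lc (GcombSh Lc) (SpureCombOf tabs cE cVH cΛ) tabs.M cE₂ cB Tc tabs.vh₂S tabs.mixFF j`,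
unit member `T̃′♮_j := unitS₂ (sfStep Lc j) (smStep d Lc j) T̃′_j`, dressed comb-chart unit step kernel `G′♮_j := unitK_j (GcombSh Lc j)`, `c₄ := cE₂·Lc^{2(d+1)}`, road-P2's (F1)
dressed source `b̃′♮_j` (NO member inside), the slotwise parity `P T κ u κ′ u′ := sgnK (trK (T κ u κ′ u′))`, the `ε`-member `y_j := ½ • (T̃′♮_j + ε • P T̃′♮_j)`; any record
`tabs : SymTables d Lc` with off-diagonal border `hBff hBmm`; generic `d`, `Lc ≥ 1` via `[NeZero Lc]`, all constants symbolic):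
* §0 comb T-EQ plumbing ([folklore]): `hH_unitK_GcombSh` — (hH) for `G′♮_j` with the `j`-FREE constant `(Lc^{d+1})⁻¹` (an2's `colH_ward_GcombSh` × asym1's `colH_unitK`;
  `sfStep·smStep = stepScale` cancels), `divW_lin4_GcombSh` ∕ `divW_lin4_GcombSh_of_symm` — T-EQ, SOURCE SLOT, FOR THE DRESSED COMB-CHART STEP (leaf-03 g58's generic
  `Lin4SlotDivergence.divW_lin4(_of_symm)` at an2's `decays_GcombSh`) — the twins of `Lin4SlotDivergence` §3 `hH_unitK_comb ∕ divW_lin4_comb(_of_symm)`.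
* §1 `bdd₄_halfMember_comb` and **`divW_halfMember_comb_succ_eq`** — T-EQ ON THE `ε`-MEMBER, HYPOTHESIS-FREE:
  `divW (y_{j+1}) y ν y′ = divW (½ • (b̃′♮_j + ε • P b̃′♮_j)) y ν y′ + (c₄·(Lc^{d+1})⁻¹∕2) • (e3OfK Lc G′♮_j F₁^{ε} ν y′ + e3OfK Lc G′♮_j F₂^{ε} ν y′)`, `F₁^{ε} ∕ F₂^{ε}` the two
  block-summed slot divergences of `y_j` (the OWNER's T5 §1 one-step law `CombT2DriftEvenEnd.halfMember_comb_succ_eq`, re-run here as a private `c`-weighted copy — T5 has no hub olean at filing time — ⨾ §0 ⨾ leaf-06's `divW_add_apply`); `divV_snd_halfMember_comb_succ_eq` —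
  the SECOND slot (road W3's map is slot-symmetric: leaf-03 g58's `lin4_swap_slots`).
* PART 2 (`GAN24/CombHalfMemberSlavedDivergenceLaws`, same seat): the SLAVING — §1 ∘ MY (E) §2 `boxSum_divV_half_fst ∕ snd_of_tableLaw` under the two RAW table laws of `T̃′_j`
  DISPLAYED (letters `S X R R″ cH′`, parities `hC hR hR″`) and the two named members (EVEN: NO `R`; ODD: NO commutator); PART 3 (next): the instances at an2's slot-generic
  table laws `WardLocusQuarticTableSlot.tableLaw_T2RecOf_succ ∕ '' ∕ _zero ∕ ''` with `G := GcombSh Lc`, parities discharged by name.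
WHAT THIS IS NOT.  Identities only: NOT the slaving (PART 2), NOT the window step ∕ letter rows (`SlotDivergenceLetters`), NOT the cells `hcell ∕ hcelld` (leaf-03's (C-6)), NOT one row of the S-∕W-slot, NO value, NO rate; asserts NOTHING about
Bałaban's tables; the (III′) campaign is NOT asked (an2 W-4 l.64553) — zero weight; NEVER «G-an2-4 closed» as (CONV-C); NOT D1, NOT `BetaPertH`, NOT continuum, NOT Clay.
2026-08-25.
-/

noncomputable section

open Finset
open scoped BigOperators
open Literature.MathematicalPhysics.QuantumFieldTheory
open Literature.MathematicalPhysics.QuantumFieldTheory.Balaban1983to89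
open Literature.MathematicalPhysics.QuantumFieldTheory.Balaban1983to89.Beta
open B6BondElimination (unitVec)
open ExpKernelCalculus (MKer Decays comp)
open OneStepResolventKernel (Fib)
open OneStepKernelFamily (KInvStep colH)
open SecondOrderResponse (W2SymOfK)
open BalabanStepJetsSucc (mmRead)
open BalabanStepW2 (K3OfK M2Of)
open KernelWard (divV divW)
open AffineAveraging (box toSite)
open BalabanCompositeJets (LocStencil₂)
open Summit.QuantumFields.BalabanUV.Beta.TameKernelCalculus (trK)
open Summit.QuantumFields.BalabanUV.Beta.BorderedHessian (sgnK stepScale)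
open Summit.QuantumFields.BalabanUV.Beta.KernelWardRelative (gaugeWt)
open Summit.QuantumFields.BalabanUV.Beta.HessKerDressedUnits (unitK unitS colH_unitK decays_unitK)
open Summit.QuantumFields.BalabanUV.Beta.SecondOrderUnits (unitM unitS₂ unitM₂)
open Summit.QuantumFields.BalabanUV.Beta.SpineRooted (T2RecOf e3OfK)
open Summit.QuantumFields.BalabanUV.Beta.SymmetrisedStepJets (SymTables)
open Summit.QuantumFields.BalabanUV.Beta.CombChartStepJets (GcombSh decays_GcombSh SpureCombOf locStencil_SpureCombOf)
open Summit.QuantumFields.BalabanUV.Beta.CombChartHColumnWard (colH_ward_GcombSh)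
open Summit.QuantumFields.BalabanUV.Beta.GAN24.CombesThomas (sfStep smStep)
open Summit.QuantumFields.BalabanUV.Beta.GAN24.T2RecursionAffine (lin4)
open Summit.QuantumFields.BalabanUV.Beta.GAN24.BiStencilZeroMode (Tab)
open Summit.QuantumFields.BalabanUV.Beta.GAN24.Lin4SlotDivergence (divW_lin4 divW_lin4_of_symm sfStep_mul_smStep lin4_swap_slots)
open Summit.QuantumFields.BalabanUV.Beta.GAN24.T2RecOfUnitSplit (unitS₂_T2RecOf_succ_eq_lin4_add step_data_of_letters bdd₄_unitS₂_T2RecOf_of_letters)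
open Summit.QuantumFields.BalabanUV.Beta.GAN24.AffineUnrollProjected (bdd₄_parity parity_add bdd₄_smul)
open Summit.QuantumFields.BalabanUV.Beta.GAN24.T2SlavedDivergence (divW_add_apply)
open Summit.QuantumFields.BalabanUV.Beta.GAN24.Lin4Additive (lin4_smul)
open Summit.QuantumFields.BalabanUV.Beta.GAN24.T2UnitSplitLevels (bdd₄_add lin4_add_of_bdd₄)
open Summit.QuantumFields.BalabanUV.Beta.GAN24.CombAffineUnrollProjected (sgnK_trK_lin4_unitK_GcombSh)

namespace Summit.QuantumFields.BalabanUV.Beta.GAN24.CombHalfMemberSlavedDivergence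

variable {d : ℕ} {Lc : ℕ} [NeZero Lc]

/-! ## §0 Comb T-EQ plumbing: (hH) for the comb-chart unit step kernel, `j`-free constant; T-EQ in a source slot -/

section Plumbing

/-- [folklore] **(hH) FOR THE NORMALISED DRESSED COMB-CHART STEP RESOLVENT, `j`-FREE CONSTANT**: for every `j`,
`Σ_μ (colH G′♮_j Lc μ (y − e_μ) κ′ u − colH G′♮_j Lc μ y κ′ u) = (Lc^{d+1})⁻¹ · gaugeWt Lc y κ′ u`, `G′♮_j := unitK (sfStep Lc j) (smStep d Lc j) (GcombSh Lc j)`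
(an2's `colH_ward_GcombSh` × asym1's `colH_unitK`: the units' factor `sfStep·smStep = stepScale` cancels the `stepScale` of `c_H(j) = (stepScale·Lc^{d+1})⁻¹`) —
the twin of leaf-03 g58's `Lin4SlotDivergence.hH_unitK_comb`. -/
theorem hH_unitK_GcombSh (j : ℕ) (y : Fin (d + 1) → ℤ) (κ' : Fin (d + 1)) (u : Fin (d + 1) → ℤ) :
    ∑ μ, (colH (unitK (sfStep Lc j) (smStep d Lc j) (GcombSh (d := d) Lc j)) Lc μ (y - unitVec μ) κ' u
        - colH (unitK (sfStep Lc j) (smStep d Lc j) (GcombSh (d := d) Lc j)) Lc μ y κ' u)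
      = ((Lc : ℝ) ^ (d + 1))⁻¹ * gaugeWt Lc y κ' u := by
  have hs : stepScale d Lc j ≠ 0 := by
    simp only [stepScale]
    exact pow_ne_zero _ (pow_ne_zero _ (Nat.cast_ne_zero.2 (NeZero.ne Lc)))
  simp only [colH_unitK, Pi.smul_apply, smul_eq_mul, ← mul_sub, ← Finset.mul_sum]
  rw [colH_ward_GcombSh (d := d) (Lc := Lc) j y κ' u, sfStep_mul_smStep, mul_inv, ← mul_assoc, ← mul_assoc, mul_inv_cancel₀ hs, one_mul]

/-- [folklore] **T-EQ, SOURCE SLOT, FOR THE DRESSED COMB-CHART STEP** (every `j`, every bounded bi-table `T`, any `c`): with `G′♮_j := unitK (sfStep Lc j) (smStep d Lc j) (GcombSh Lc j)`,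
`divW (lin4 c G′♮_j Lc T) y ν y′ = (c·(Lc^{d+1})⁻¹ ∕ 2) • (e3OfK Lc G′♮_j F₁ ν y′ + e3OfK Lc G′♮_j F₂ ν y′)`, `F₁ ∕ F₂` the two block-summed slot divergences of `T`
(leaf-03 g58's generic `divW_lin4` at an2's `decays_GcombSh` and §0 (hH)) — the twin of `Lin4SlotDivergence.divW_lin4_comb`. -/
theorem divW_lin4_GcombSh (j : ℕ) (c : ℝ)
    {T : Fin (d + 1) → (Fin (d + 1) → ℤ) → Fin (d + 1) → (Fin (d + 1) → ℤ) → MKer (d + 1) (Fib d)} {B : ℝ}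
    (hT : ∀ κ u κ' u' x z a b, |T κ u κ' u' x z a b| ≤ B) (y : Fin (d + 1) → ℤ) (ν : Fin (d + 1)) (y' : Fin (d + 1) → ℤ) :
    divW (lin4 c (unitK (sfStep Lc j) (smStep d Lc j) (GcombSh (d := d) Lc j)) Lc T) y ν y'
      = (c * ((Lc : ℝ) ^ (d + 1))⁻¹ / 2) •
        (e3OfK Lc (unitK (sfStep Lc j) (smStep d Lc j) (GcombSh (d := d) Lc j))
            (fun κ' u' => ∑ v ∈ box (d + 1) Lc, divV (fun κ u => T κ u κ' u') ((Lc : ℤ) • y + toSite v)) ν y'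
          + e3OfK Lc (unitK (sfStep Lc j) (smStep d Lc j) (GcombSh (d := d) Lc j))
            (fun κ u => ∑ v ∈ box (d + 1) Lc, divV (T κ u) ((Lc : ℤ) • y + toSite v)) ν y') := by
  obtain ⟨δK, CK, hδK, -, hG⟩ := decays_GcombSh (d := d) Lc j
  exact divW_lin4 (decays_unitK hG) hδK c hT (hH_unitK_GcombSh j) y ν y'

/-- [folklore] **T-EQ, SOURCE SLOT, FOR THE DRESSED COMB-CHART STEP, SYMMETRIC TABLE**: if `T κ u κ′ u′ = T κ′ u′ κ u` the two halves coincide: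
`divW (lin4 c G′♮_j Lc T) y ν y′ = (c·(Lc^{d+1})⁻¹) • e3OfK Lc G′♮_j F₂ ν y′` — the twin of `Lin4SlotDivergence.divW_lin4_comb_of_symm`. -/
theorem divW_lin4_GcombSh_of_symm (j : ℕ) (c : ℝ)
    {T : Fin (d + 1) → (Fin (d + 1) → ℤ) → Fin (d + 1) → (Fin (d + 1) → ℤ) → MKer (d + 1) (Fib d)} {B : ℝ}
    (hT : ∀ κ u κ' u' x z a b, |T κ u κ' u' x z a b| ≤ B) (hsym : ∀ κ u κ' u', T κ u κ' u' = T κ' u' κ u)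
    (y : Fin (d + 1) → ℤ) (ν : Fin (d + 1)) (y' : Fin (d + 1) → ℤ) :
    divW (lin4 c (unitK (sfStep Lc j) (smStep d Lc j) (GcombSh (d := d) Lc j)) Lc T) y ν y'
      = (c * ((Lc : ℝ) ^ (d + 1))⁻¹) •
        e3OfK Lc (unitK (sfStep Lc j) (smStep d Lc j) (GcombSh (d := d) Lc j))
          (fun κ u => ∑ v ∈ box (d + 1) Lc, divV (T κ u) ((Lc : ℤ) • y + toSite v)) ν y' := by
  obtain ⟨δK, CK, hδK, -, hG⟩ := decays_GcombSh (d := d) Lc j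
  exact divW_lin4_of_symm (decays_unitK hG) hδK c hT hsym (hH_unitK_GcombSh j) y ν y'

end Plumbing

/-! ## §1 T-EQ on the `ε`-member of the comb-chart tower (hypothesis-free) -/

section Member

/-- [folklore] **THE `ε`-MEMBER's ONE-STEP LAW FOR THE COMB-CHART TOWER, ANY WEIGHT `c`**: `c • (T̃′♮_{j+1} + ε • P T̃′♮_{j+1}) = 𝒜^{G′}_j (c • (T̃′♮_j + ε • P T̃′♮_j)) +
c • (b̃′♮_j + ε • P b̃′♮_j)` — at `c = ½` this is EXACTLY the OWNER gan24-p1 g46's T5 §1 `CombT2DriftEvenEnd.halfMember_comb_succ_eq` (one home per statement: T5; its module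
has no hub olean at this file's filing time, so T5 is not imported here); proof = T5's, token for token, with `½ ↦ c`: road-P2's slot-generic (F1) step
`unitS₂_T2RecOf_succ_eq_lin4_add` with `step_data_of_letters` ∕ `bdd₄_unitS₂_T2RecOf_of_letters` (the record's letters, an2's `decays_GcombSh` ∕ `locStencil_SpureCombOf`), the
parity through the dressed comb step by the OWNER's `CombAffineUnrollProjected.sgnK_trK_lin4_unitK_GcombSh`, `lin4` linear on bounded tables.  Private: a proof device. -/
private theorem smul_halfMember_comb_succ_eq (tabs : SymTables d Lc) (cE cVH cΛ cE₂ cB : ℝ) (Tc : Fin 4 → Fin 4 → Fin 4 → Fin 4 → ℝ)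
    (hBff : ∀ κ u κ' u' x z (α β : Fin (d + 1)), tabs.vh₂S κ u κ' u' x z (Sum.inl α) (Sum.inl β) = 0)
    (hBmm : ∀ κ u κ' u' x z (μ ν : Fin (d + 1)), tabs.vh₂S κ u κ' u' x z (Sum.inr μ) (Sum.inr ν) = 0) (c ε : ℝ) (j : ℕ) :
    (c • (unitS₂ (sfStep Lc (j + 1)) (smStep d Lc (j + 1)) (T2RecOf d Lc (GcombSh Lc) (SpureCombOf tabs cE cVH cΛ) tabs.M cE₂ cB Tc tabs.vh₂S tabs.mixFF (j + 1))
          + ε • fun κ u κ' u' => sgnK (trK (unitS₂ (sfStep Lc (j + 1)) (smStep d Lc (j + 1))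
            (T2RecOf d Lc (GcombSh Lc) (SpureCombOf tabs cE cVH cΛ) tabs.M cE₂ cB Tc tabs.vh₂S tabs.mixFF (j + 1)) κ u κ' u'))))
      = lin4 (cE₂ * (Lc : ℝ) ^ (2 * (d + 1))) (unitK (sfStep Lc j) (smStep d Lc j) (GcombSh (d := d) Lc j)) Lc
          (c • (unitS₂ (sfStep Lc j) (smStep d Lc j) (T2RecOf d Lc (GcombSh Lc) (SpureCombOf tabs cE cVH cΛ) tabs.M cE₂ cB Tc tabs.vh₂S tabs.mixFF j)
          + ε • fun κ u κ' u' => sgnK (trK (unitS₂ (sfStep Lc j) (smStep d Lc j)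
            (T2RecOf d Lc (GcombSh Lc) (SpureCombOf tabs cE cVH cΛ) tabs.M cE₂ cB Tc tabs.vh₂S tabs.mixFF j) κ u κ' u'))))
        + (c • ((fun κ u κ' u' => (cE₂ * (Lc : ℝ) ^ (2 * (d + 1))) • mmRead Lc (K3OfK
            (unitK (sfStep Lc j) (smStep d Lc j) (GcombSh (d := d) Lc j)) Lc
            (unitS (sfStep Lc j) (smStep d Lc j) (SpureCombOf tabs cE cVH cΛ j)) (unitM (sfStep Lc j) (smStep d Lc j) (tabs.M j))
            (W2SymOfK (unitK (sfStep Lc j) (smStep d Lc j) (GcombSh (d := d) Lc j)) Lc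
              (unitS (sfStep Lc j) (smStep d Lc j) (SpureCombOf tabs cE cVH cΛ j)) (unitM (sfStep Lc j) (smStep d Lc j) (tabs.M j)) 0
              (unitM₂ (sfStep Lc j) (smStep d Lc j) (M2Of d Lc tabs.mixFF j))) κ u κ' u') + cB • tabs.vh₂S κ u κ' u')
          + ε • fun κ u κ' u' => sgnK (trK ((fun κ u κ' u' => (cE₂ * (Lc : ℝ) ^ (2 * (d + 1))) • mmRead Lc (K3OfK
            (unitK (sfStep Lc j) (smStep d Lc j) (GcombSh (d := d) Lc j)) Lc
            (unitS (sfStep Lc j) (smStep d Lc j) (SpureCombOf tabs cE cVH cΛ j)) (unitM (sfStep Lc j) (smStep d Lc j) (tabs.M j))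
            (W2SymOfK (unitK (sfStep Lc j) (smStep d Lc j) (GcombSh (d := d) Lc j)) Lc
              (unitS (sfStep Lc j) (smStep d Lc j) (SpureCombOf tabs cE cVH cΛ j)) (unitM (sfStep Lc j) (smStep d Lc j) (tabs.M j)) 0
              (unitM₂ (sfStep Lc j) (smStep d Lc j) (M2Of d Lc tabs.mixFF j))) κ u κ' u') + cB • tabs.vh₂S κ u κ' u') κ u κ' u')))) := by
  have hLc : 1 ≤ Lc := NeZero.one_le
  -- road-P2's (F1) step at the comb letters: `T̃′_{j+1} = 𝒜^{G′}_j T̃′_j + b̃′_j`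
  obtain ⟨C, δ, C₀, C₁, hδ, hK, h₀, hW⟩ := step_data_of_letters (GcombSh Lc) (SpureCombOf tabs cE cVH cΛ) tabs.M cE₂ cB Tc hLc
      (decays_GcombSh (d := d) Lc) (locStencil_SpureCombOf tabs cE cVH cΛ) tabs.hM tabs.hB tabs.hmix j
  have hstep := unitS₂_T2RecOf_succ_eq_lin4_add (GcombSh Lc) (SpureCombOf tabs cE cVH cΛ) tabs.M cE₂ cB Tc tabs.vh₂S tabs.mixFF hBff hBmm j hδ hK h₀ hW
  -- the member is bounded, and so is its parity image
  have hbU := bdd₄_unitS₂_T2RecOf_of_letters (GcombSh Lc) (SpureCombOf tabs cE cVH cΛ) tabs.M cE₂ cB Tc hLc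
      (decays_GcombSh (d := d) Lc) (locStencil_SpureCombOf tabs cE cVH cΛ) tabs.hM tabs.hB tabs.hmix j
  have hbP := bdd₄_smul ε (bdd₄_parity hbU)
  obtain ⟨δK, CK, hδK, -, hG⟩ := decays_GcombSh (d := d) Lc j
  rw [hstep, parity_add, sgnK_trK_lin4_unitK_GcombSh j _ _ _ _ hbU, lin4_smul,
    lin4_add_of_bdd₄ (decays_unitK (sf := sfStep Lc j) (sm := smStep d Lc j) hG) hδK _ _ hbU hbP, lin4_smul]
  simp only [smul_add]
  abel


/-- [folklore] **THE `ε`-MEMBER OF THE COMB-CHART TOWER IS BOUNDED** (entries; road-P2's `bdd₄_unitS₂_T2RecOf_of_letters` with the record's letters ⨾ `bdd₄_parity ∕ bdd₄_smul ∕ bdd₄_add`). -/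
theorem bdd₄_halfMember_comb (tabs : SymTables d Lc) (cE cVH cΛ cE₂ cB : ℝ) (Tc : Fin 4 → Fin 4 → Fin 4 → Fin 4 → ℝ)
    (ε : ℝ) (j : ℕ) :
    ∃ B : ℝ, ∀ κ u κ' u' x z a b,
      |((1 / 2 : ℝ) • (unitS₂ (sfStep Lc j) (smStep d Lc j) (T2RecOf d Lc (GcombSh Lc) (SpureCombOf tabs cE cVH cΛ) tabs.M cE₂ cB Tc tabs.vh₂S tabs.mixFF j)
          + ε • fun κ u κ' u' => sgnK (trK (unitS₂ (sfStep Lc j) (smStep d Lc j) (T2RecOf d Lc (GcombSh Lc) (SpureCombOf tabs cE cVH cΛ) tabs.M cE₂ cB Tc tabs.vh₂S tabs.mixFF j) κ u κ' u')))) κ u κ' u' x z a b| ≤ B := by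
  have hbU := bdd₄_unitS₂_T2RecOf_of_letters (GcombSh Lc) (SpureCombOf tabs cE cVH cΛ) tabs.M cE₂ cB Tc NeZero.one_le
      (decays_GcombSh (d := d) Lc) (locStencil_SpureCombOf tabs cE cVH cΛ) tabs.hM tabs.hB tabs.hmix j
  exact bdd₄_smul (1 / 2 : ℝ) (bdd₄_add hbU (bdd₄_smul ε (bdd₄_parity hbU)))

/-- NOT IN PRINT; OUR BOOKKEEPING.  **T-EQ ON THE `ε`-MEMBER OF THE COMB-CHART `T₂` TOWER** (every `ε j y ν y′`; any sym record with off-diagonal border `hBff hBmm`):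
with `y_j := ½ • (T̃′♮_j + ε • P T̃′♮_j)`,
`divW (y_{j+1}) y ν y′ = divW (½ • (b̃′♮_j + ε • P b̃′♮_j)) y ν y′ + (c₄·(Lc^{d+1})⁻¹∕2) • (e3OfK Lc G′♮_j F₁^{ε} ν y′ + e3OfK Lc G′♮_j F₂^{ε} ν y′)`,
`F₁^{ε} κ′ u′ := Σ_{v∈box} divV (κ u ↦ y_j κ u κ′ u′) (Lc•y + toSite v)`, `F₂^{ε} κ u := Σ_v divV (y_j κ u) (Lc•y + toSite v)` — the OWNER's T5 §1 one-step law
(`CombT2DriftEvenEnd.halfMember_comb_succ_eq`; here the private `c`-weighted copy `smul_halfMember_comb_succ_eq` at `c = ½`), then §0 `divW_lin4_GcombSh` on the bounded `y_j` and leaf-06's `divW_add_apply`; NO commutation of `P` with `e3OfK` is used.  The twin of MY g72 `divW_halfMember_succ_eq`. -/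
theorem divW_halfMember_comb_succ_eq (tabs : SymTables d Lc) (cE cVH cΛ cE₂ cB : ℝ) (Tc : Fin 4 → Fin 4 → Fin 4 → Fin 4 → ℝ)
    (hBff : ∀ κ u κ' u' x z (α β : Fin (d + 1)), tabs.vh₂S κ u κ' u' x z (Sum.inl α) (Sum.inl β) = 0)
    (hBmm : ∀ κ u κ' u' x z (μ ν : Fin (d + 1)), tabs.vh₂S κ u κ' u' x z (Sum.inr μ) (Sum.inr ν) = 0) (ε : ℝ) (j : ℕ)
    (y : Fin (d + 1) → ℤ) (ν : Fin (d + 1)) (y' : Fin (d + 1) → ℤ) :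
    divW ((1 / 2 : ℝ) • (unitS₂ (sfStep Lc (j + 1)) (smStep d Lc (j + 1)) (T2RecOf d Lc (GcombSh Lc) (SpureCombOf tabs cE cVH cΛ) tabs.M cE₂ cB Tc tabs.vh₂S tabs.mixFF (j + 1))
          + ε • fun κ u κ' u' => sgnK (trK (unitS₂ (sfStep Lc (j + 1)) (smStep d Lc (j + 1)) (T2RecOf d Lc (GcombSh Lc) (SpureCombOf tabs cE cVH cΛ) tabs.M cE₂ cB Tc tabs.vh₂S tabs.mixFF (j + 1)) κ u κ' u')))) y ν y'
      = divW ((1 / 2 : ℝ) • ((fun κ u κ' u' => (cE₂ * (Lc : ℝ) ^ (2 * (d + 1))) • mmRead Lc (K3OfK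
            (unitK (sfStep Lc j) (smStep d Lc j) (GcombSh (d := d) Lc j)) Lc
            (unitS (sfStep Lc j) (smStep d Lc j) (SpureCombOf tabs cE cVH cΛ j)) (unitM (sfStep Lc j) (smStep d Lc j) (tabs.M j))
            (W2SymOfK (unitK (sfStep Lc j) (smStep d Lc j) (GcombSh (d := d) Lc j)) Lc
              (unitS (sfStep Lc j) (smStep d Lc j) (SpureCombOf tabs cE cVH cΛ j)) (unitM (sfStep Lc j) (smStep d Lc j) (tabs.M j)) 0
              (unitM₂ (sfStep Lc j) (smStep d Lc j) (M2Of d Lc tabs.mixFF j))) κ u κ' u') + cB • tabs.vh₂S κ u κ' u')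
          + ε • fun κ u κ' u' => sgnK (trK ((fun κ u κ' u' => (cE₂ * (Lc : ℝ) ^ (2 * (d + 1))) • mmRead Lc (K3OfK
            (unitK (sfStep Lc j) (smStep d Lc j) (GcombSh (d := d) Lc j)) Lc
            (unitS (sfStep Lc j) (smStep d Lc j) (SpureCombOf tabs cE cVH cΛ j)) (unitM (sfStep Lc j) (smStep d Lc j) (tabs.M j))
            (W2SymOfK (unitK (sfStep Lc j) (smStep d Lc j) (GcombSh (d := d) Lc j)) Lc
              (unitS (sfStep Lc j) (smStep d Lc j) (SpureCombOf tabs cE cVH cΛ j)) (unitM (sfStep Lc j) (smStep d Lc j) (tabs.M j)) 0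
              (unitM₂ (sfStep Lc j) (smStep d Lc j) (M2Of d Lc tabs.mixFF j))) κ u κ' u') + cB • tabs.vh₂S κ u κ' u') κ u κ' u')))) y ν y'
        + (cE₂ * (Lc : ℝ) ^ (2 * (d + 1)) * ((Lc : ℝ) ^ (d + 1))⁻¹ / 2) •
          (e3OfK Lc (unitK (sfStep Lc j) (smStep d Lc j) (GcombSh (d := d) Lc j))
              (fun κ' u' => ∑ v ∈ box (d + 1) Lc, divV (fun κ u =>
                ((1 / 2 : ℝ) • (unitS₂ (sfStep Lc j) (smStep d Lc j) (T2RecOf d Lc (GcombSh Lc) (SpureCombOf tabs cE cVH cΛ) tabs.M cE₂ cB Tc tabs.vh₂S tabs.mixFF j)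
          + ε • fun κ u κ' u' => sgnK (trK (unitS₂ (sfStep Lc j) (smStep d Lc j) (T2RecOf d Lc (GcombSh Lc) (SpureCombOf tabs cE cVH cΛ) tabs.M cE₂ cB Tc tabs.vh₂S tabs.mixFF j) κ u κ' u')))) κ u κ' u')
                ((Lc : ℤ) • y + toSite v)) ν y'
            + e3OfK Lc (unitK (sfStep Lc j) (smStep d Lc j) (GcombSh (d := d) Lc j))
              (fun κ u => ∑ v ∈ box (d + 1) Lc, divV
                (((1 / 2 : ℝ) • (unitS₂ (sfStep Lc j) (smStep d Lc j) (T2RecOf d Lc (GcombSh Lc) (SpureCombOf tabs cE cVH cΛ) tabs.M cE₂ cB Tc tabs.vh₂S tabs.mixFF j)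
          + ε • fun κ u κ' u' => sgnK (trK (unitS₂ (sfStep Lc j) (smStep d Lc j) (T2RecOf d Lc (GcombSh Lc) (SpureCombOf tabs cE cVH cΛ) tabs.M cE₂ cB Tc tabs.vh₂S tabs.mixFF j) κ u κ' u')))) κ u)
                ((Lc : ℤ) • y + toSite v)) ν y') := by
  obtain ⟨B, hBy⟩ := bdd₄_halfMember_comb tabs cE cVH cΛ cE₂ cB Tc ε j
  rw [smul_halfMember_comb_succ_eq tabs cE cVH cΛ cE₂ cB Tc hBff hBmm (1 / 2 : ℝ) ε j, divW_add_apply, divW_lin4_GcombSh j _ hBy y ν y']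
  exact add_comm _ _


/-- NOT IN PRINT; OUR BOOKKEEPING.  **T-EQ ON THE `ε`-MEMBER, SECOND SLOT** (hypothesis-free; every `ε j p κ u`): `divV (y_{j+1} κ u) p = divV ((½ • (b̃′♮_j + ε • P b̃′♮_j)) κ u) p
+ (c₄·(Lc^{d+1})⁻¹∕2) • (e3OfK Lc G′♮_j F₁^{ε}(p) κ u + e3OfK Lc G′♮_j F₂^{ε}(p) κ u)` — the SAME two summands as the first slot (PART 1 §1) read at the slot `(κ, u)`: road W3's
one-step map is slot-symmetric (leaf-03 g58's `Lin4SlotDivergence.lin4_swap_slots`), so the second-slot divergence of `𝒜^Ĝ_j y_j` is its first-slot divergence (the one-step law ⨾ swap ⨾ §0 `divW_lin4_GcombSh`).  The twin of MY g72 `divV_snd_halfMember_succ_eq`. -/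
theorem divV_snd_halfMember_comb_succ_eq (tabs : SymTables d Lc) (cE cVH cΛ cE₂ cB : ℝ) (Tc : Fin 4 → Fin 4 → Fin 4 → Fin 4 → ℝ)
    (hBff : ∀ κ u κ' u' x z (α β : Fin (d + 1)), tabs.vh₂S κ u κ' u' x z (Sum.inl α) (Sum.inl β) = 0)
    (hBmm : ∀ κ u κ' u' x z (μ ν : Fin (d + 1)), tabs.vh₂S κ u κ' u' x z (Sum.inr μ) (Sum.inr ν) = 0) (ε : ℝ) (j : ℕ)
    (p : Fin (d + 1) → ℤ) (κ : Fin (d + 1)) (u : Fin (d + 1) → ℤ) :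
    divV (((1 / 2 : ℝ) • (unitS₂ (sfStep Lc (j + 1)) (smStep d Lc (j + 1)) (T2RecOf d Lc (GcombSh Lc) (SpureCombOf tabs cE cVH cΛ) tabs.M cE₂ cB Tc tabs.vh₂S tabs.mixFF (j + 1))
          + ε • fun κ u κ' u' => sgnK (trK (unitS₂ (sfStep Lc (j + 1)) (smStep d Lc (j + 1)) (T2RecOf d Lc (GcombSh Lc) (SpureCombOf tabs cE cVH cΛ) tabs.M cE₂ cB Tc tabs.vh₂S tabs.mixFF (j + 1)) κ u κ' u')))) κ u) p
      = divV (((1 / 2 : ℝ) • ((fun κ u κ' u' => (cE₂ * (Lc : ℝ) ^ (2 * (d + 1))) • mmRead Lc (K3OfK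
            (unitK (sfStep Lc j) (smStep d Lc j) (GcombSh (d := d) Lc j)) Lc
            (unitS (sfStep Lc j) (smStep d Lc j) (SpureCombOf tabs cE cVH cΛ j)) (unitM (sfStep Lc j) (smStep d Lc j) (tabs.M j))
            (W2SymOfK (unitK (sfStep Lc j) (smStep d Lc j) (GcombSh (d := d) Lc j)) Lc
              (unitS (sfStep Lc j) (smStep d Lc j) (SpureCombOf tabs cE cVH cΛ j)) (unitM (sfStep Lc j) (smStep d Lc j) (tabs.M j)) 0
              (unitM₂ (sfStep Lc j) (smStep d Lc j) (M2Of d Lc tabs.mixFF j))) κ u κ' u') + cB • tabs.vh₂S κ u κ' u')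
          + ε • fun κ u κ' u' => sgnK (trK ((fun κ u κ' u' => (cE₂ * (Lc : ℝ) ^ (2 * (d + 1))) • mmRead Lc (K3OfK
            (unitK (sfStep Lc j) (smStep d Lc j) (GcombSh (d := d) Lc j)) Lc
            (unitS (sfStep Lc j) (smStep d Lc j) (SpureCombOf tabs cE cVH cΛ j)) (unitM (sfStep Lc j) (smStep d Lc j) (tabs.M j))
            (W2SymOfK (unitK (sfStep Lc j) (smStep d Lc j) (GcombSh (d := d) Lc j)) Lc
              (unitS (sfStep Lc j) (smStep d Lc j) (SpureCombOf tabs cE cVH cΛ j)) (unitM (sfStep Lc j) (smStep d Lc j) (tabs.M j)) 0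
              (unitM₂ (sfStep Lc j) (smStep d Lc j) (M2Of d Lc tabs.mixFF j))) κ u κ' u') + cB • tabs.vh₂S κ u κ' u') κ u κ' u')))) κ u) p
        + (cE₂ * (Lc : ℝ) ^ (2 * (d + 1)) * ((Lc : ℝ) ^ (d + 1))⁻¹ / 2) •
          (e3OfK Lc (unitK (sfStep Lc j) (smStep d Lc j) (GcombSh (d := d) Lc j))
              (fun κ' u' => ∑ v ∈ box (d + 1) Lc, divV (fun κ₁ u₁ =>
                ((1 / 2 : ℝ) • (unitS₂ (sfStep Lc j) (smStep d Lc j) (T2RecOf d Lc (GcombSh Lc) (SpureCombOf tabs cE cVH cΛ) tabs.M cE₂ cB Tc tabs.vh₂S tabs.mixFF j)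
          + ε • fun κ u κ' u' => sgnK (trK (unitS₂ (sfStep Lc j) (smStep d Lc j) (T2RecOf d Lc (GcombSh Lc) (SpureCombOf tabs cE cVH cΛ) tabs.M cE₂ cB Tc tabs.vh₂S tabs.mixFF j) κ u κ' u')))) κ₁ u₁ κ' u')
                ((Lc : ℤ) • p + toSite v)) κ u
            + e3OfK Lc (unitK (sfStep Lc j) (smStep d Lc j) (GcombSh (d := d) Lc j))
              (fun κ₁ u₁ => ∑ v ∈ box (d + 1) Lc, divV
                (((1 / 2 : ℝ) • (unitS₂ (sfStep Lc j) (smStep d Lc j) (T2RecOf d Lc (GcombSh Lc) (SpureCombOf tabs cE cVH cΛ) tabs.M cE₂ cB Tc tabs.vh₂S tabs.mixFF j)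
          + ε • fun κ u κ' u' => sgnK (trK (unitS₂ (sfStep Lc j) (smStep d Lc j) (T2RecOf d Lc (GcombSh Lc) (SpureCombOf tabs cE cVH cΛ) tabs.M cE₂ cB Tc tabs.vh₂S tabs.mixFF j) κ u κ' u')))) κ₁ u₁)
                ((Lc : ℤ) • p + toSite v)) κ u) := by
  obtain ⟨B, hBy⟩ := bdd₄_halfMember_comb tabs cE cVH cΛ cE₂ cB Tc ε j
  -- the second-slot divergence is the first-slot divergence of the slot-swapped table
  have e : divV (((1 / 2 : ℝ) • (unitS₂ (sfStep Lc (j + 1)) (smStep d Lc (j + 1)) (T2RecOf d Lc (GcombSh Lc) (SpureCombOf tabs cE cVH cΛ) tabs.M cE₂ cB Tc tabs.vh₂S tabs.mixFF (j + 1))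
          + ε • fun κ u κ' u' => sgnK (trK (unitS₂ (sfStep Lc (j + 1)) (smStep d Lc (j + 1)) (T2RecOf d Lc (GcombSh Lc) (SpureCombOf tabs cE cVH cΛ) tabs.M cE₂ cB Tc tabs.vh₂S tabs.mixFF (j + 1)) κ u κ' u')))) κ u) p
      = divW (fun μ q κ' u' => ((1 / 2 : ℝ) • (unitS₂ (sfStep Lc (j + 1)) (smStep d Lc (j + 1)) (T2RecOf d Lc (GcombSh Lc) (SpureCombOf tabs cE cVH cΛ) tabs.M cE₂ cB Tc tabs.vh₂S tabs.mixFF (j + 1))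
          + ε • fun κ u κ' u' => sgnK (trK (unitS₂ (sfStep Lc (j + 1)) (smStep d Lc (j + 1)) (T2RecOf d Lc (GcombSh Lc) (SpureCombOf tabs cE cVH cΛ) tabs.M cE₂ cB Tc tabs.vh₂S tabs.mixFF (j + 1)) κ u κ' u')))) κ' u' μ q) p κ u := rfl
  rw [e, smul_halfMember_comb_succ_eq tabs cE cVH cΛ cE₂ cB Tc hBff hBmm (1 / 2 : ℝ) ε j]
  have e2 : (fun μ q κ' u' => (lin4 (cE₂ * (Lc : ℝ) ^ (2 * (d + 1))) (unitK (sfStep Lc j) (smStep d Lc j) (GcombSh (d := d) Lc j)) Lc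
          ((1 / 2 : ℝ) • (unitS₂ (sfStep Lc j) (smStep d Lc j) (T2RecOf d Lc (GcombSh Lc) (SpureCombOf tabs cE cVH cΛ) tabs.M cE₂ cB Tc tabs.vh₂S tabs.mixFF j)
          + ε • fun κ u κ' u' => sgnK (trK (unitS₂ (sfStep Lc j) (smStep d Lc j) (T2RecOf d Lc (GcombSh Lc) (SpureCombOf tabs cE cVH cΛ) tabs.M cE₂ cB Tc tabs.vh₂S tabs.mixFF j) κ u κ' u'))))
        + ((1 / 2 : ℝ) • ((fun κ u κ' u' => (cE₂ * (Lc : ℝ) ^ (2 * (d + 1))) • mmRead Lc (K3OfK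
            (unitK (sfStep Lc j) (smStep d Lc j) (GcombSh (d := d) Lc j)) Lc
            (unitS (sfStep Lc j) (smStep d Lc j) (SpureCombOf tabs cE cVH cΛ j)) (unitM (sfStep Lc j) (smStep d Lc j) (tabs.M j))
            (W2SymOfK (unitK (sfStep Lc j) (smStep d Lc j) (GcombSh (d := d) Lc j)) Lc
              (unitS (sfStep Lc j) (smStep d Lc j) (SpureCombOf tabs cE cVH cΛ j)) (unitM (sfStep Lc j) (smStep d Lc j) (tabs.M j)) 0
              (unitM₂ (sfStep Lc j) (smStep d Lc j) (M2Of d Lc tabs.mixFF j))) κ u κ' u') + cB • tabs.vh₂S κ u κ' u')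
          + ε • fun κ u κ' u' => sgnK (trK ((fun κ u κ' u' => (cE₂ * (Lc : ℝ) ^ (2 * (d + 1))) • mmRead Lc (K3OfK
            (unitK (sfStep Lc j) (smStep d Lc j) (GcombSh (d := d) Lc j)) Lc
            (unitS (sfStep Lc j) (smStep d Lc j) (SpureCombOf tabs cE cVH cΛ j)) (unitM (sfStep Lc j) (smStep d Lc j) (tabs.M j))
            (W2SymOfK (unitK (sfStep Lc j) (smStep d Lc j) (GcombSh (d := d) Lc j)) Lc
              (unitS (sfStep Lc j) (smStep d Lc j) (SpureCombOf tabs cE cVH cΛ j)) (unitM (sfStep Lc j) (smStep d Lc j) (tabs.M j)) 0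
              (unitM₂ (sfStep Lc j) (smStep d Lc j) (M2Of d Lc tabs.mixFF j))) κ u κ' u') + cB • tabs.vh₂S κ u κ' u') κ u κ' u'))))) κ' u' μ q)
      = lin4 (cE₂ * (Lc : ℝ) ^ (2 * (d + 1))) (unitK (sfStep Lc j) (smStep d Lc j) (GcombSh (d := d) Lc j)) Lc
          ((1 / 2 : ℝ) • (unitS₂ (sfStep Lc j) (smStep d Lc j) (T2RecOf d Lc (GcombSh Lc) (SpureCombOf tabs cE cVH cΛ) tabs.M cE₂ cB Tc tabs.vh₂S tabs.mixFF j)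
          + ε • fun κ u κ' u' => sgnK (trK (unitS₂ (sfStep Lc j) (smStep d Lc j) (T2RecOf d Lc (GcombSh Lc) (SpureCombOf tabs cE cVH cΛ) tabs.M cE₂ cB Tc tabs.vh₂S tabs.mixFF j) κ u κ' u'))))
        + fun μ q κ' u' => ((1 / 2 : ℝ) • ((fun κ u κ' u' => (cE₂ * (Lc : ℝ) ^ (2 * (d + 1))) • mmRead Lc (K3OfK
            (unitK (sfStep Lc j) (smStep d Lc j) (GcombSh (d := d) Lc j)) Lc
            (unitS (sfStep Lc j) (smStep d Lc j) (SpureCombOf tabs cE cVH cΛ j)) (unitM (sfStep Lc j) (smStep d Lc j) (tabs.M j))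
            (W2SymOfK (unitK (sfStep Lc j) (smStep d Lc j) (GcombSh (d := d) Lc j)) Lc
              (unitS (sfStep Lc j) (smStep d Lc j) (SpureCombOf tabs cE cVH cΛ j)) (unitM (sfStep Lc j) (smStep d Lc j) (tabs.M j)) 0
              (unitM₂ (sfStep Lc j) (smStep d Lc j) (M2Of d Lc tabs.mixFF j))) κ u κ' u') + cB • tabs.vh₂S κ u κ' u')
          + ε • fun κ u κ' u' => sgnK (trK ((fun κ u κ' u' => (cE₂ * (Lc : ℝ) ^ (2 * (d + 1))) • mmRead Lc (K3OfK
            (unitK (sfStep Lc j) (smStep d Lc j) (GcombSh (d := d) Lc j)) Lc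
            (unitS (sfStep Lc j) (smStep d Lc j) (SpureCombOf tabs cE cVH cΛ j)) (unitM (sfStep Lc j) (smStep d Lc j) (tabs.M j))
            (W2SymOfK (unitK (sfStep Lc j) (smStep d Lc j) (GcombSh (d := d) Lc j)) Lc
              (unitS (sfStep Lc j) (smStep d Lc j) (SpureCombOf tabs cE cVH cΛ j)) (unitM (sfStep Lc j) (smStep d Lc j) (tabs.M j)) 0
              (unitM₂ (sfStep Lc j) (smStep d Lc j) (M2Of d Lc tabs.mixFF j))) κ u κ' u') + cB • tabs.vh₂S κ u κ' u') κ u κ' u')))) κ' u' μ q := by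
    funext μ q κ' u'
    simp only [Pi.add_apply]
    rw [lin4_swap_slots]
  rw [e2, divW_add_apply, divW_lin4_GcombSh j _ hBy p κ u]
  exact add_comm _ _

end Member

end Summit.QuantumFields.BalabanUV.Beta.GAN24.CombHalfMemberSlavedDivergence

end
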